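import Summits.Ventures.HodgeRepro2.T7SupportBergmanConjTorus
import Summits.Ventures.HodgeRepro2.T7SupportKappaCartan
import Summits.Ventures.HodgeRepro2.T5BergmanKTypeMatrix

/-!
# The two-torus orbital integral decays like `κ(γ)^{−k/2}` (support, seat p1)

Assembling `T7SupportBergmanConjTorus` (the orbital integral for the tori `K`, `h K h⁻¹` is bounded by the
coefficient `⟨π_k(γ h) zʲ, zⁿ⟩_k`), `T5BergmanKTypeMatrix.norm_matrixCoeff_monomial_monomial_le` (the coefficient
is `≤ C ‖a(γ h)‖^{−k}`) and `T7SupportKappaCartan.kappa_eq_normSq` (`κ(γ) = |a(γ h)|²`):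

  `‖∫_K ∫_K ⟨π_k(rot u · γ · h rot v h⁻¹) π_k(h) zʲ, zⁿ⟩_k · u^p · conj(v^q)‖ ≤ C · κ(γ)^{−k/2}`

(`norm_torus_orbital_conj_le_kappa`, `C = decayConst k j n · monomialNormSq k n`), with `κ(γ) ≥ 1`: the
archimedean orbital integral of the explicit model decays polynomially in the double-coset invariant, exponent
`k/2` — the `a_bound` shape of `T7SupportDominantTermPolynomial` (`α = k/2`, i.e. `3/2` for `k = 3`).

Explicit model only; nothing about the adelic group, the global invariant, or any period.
Blind lane: Mathlib + the HodgeRepro2 prefix only; no sorry; axioms ⊆ {propext, Classical.choice, Quot.sound}.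
-/

namespace Summit.Ventures.HodgeRepro2.T7SupportBergmanOrbitalDecay

open MeasureTheory
open T5SU11Unimodular T5SU11Fibration T5BergmanCoefficient T5BergmanMatrixCoeff T5HaarCircle
  T5BergmanKTypeMatrix T5BergmanParseval T5BergmanActStable T7SupportBergmanConjTorus T7SupportKappaCartan
  T7SupportTwoTorusInvariant

/-- `‖a‖⁻¹ ^ k = (|a|²)^{−k/2}` for `a ≠ 0` -/
theorem inv_pow_eq_normSq_rpow {a : ℂ} (ha : a ≠ 0) (k : ℕ) :
    ‖a‖⁻¹ ^ k = Complex.normSq a ^ (-(k : ℝ) / 2) := by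
  have h0 : 0 < ‖a‖ := norm_pos_iff.2 ha
  rw [Complex.normSq_eq_norm_sq, ← Real.rpow_natCast (‖a‖) 2, ← Real.rpow_mul h0.le]
  have e : ((2 : ℕ) : ℝ) * (-(k : ℝ) / 2) = -(k : ℝ) := by push_cast; ring
  rw [e, Real.rpow_neg h0.le, Real.rpow_natCast, inv_pow]

variable [MeasurableSpace Circle] [BorelSpace Circle]

/-- **the orbital integral decays like `κ(γ)^{−k/2}`** -/
theorem norm_torus_orbital_conj_le_kappa (k j n : ℕ) (hk : 2 ≤ k) (h γ : SU11) (p q : ℤ) :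
    ‖∫ u : Circle, ∫ v : Circle,
        matrixCoeff k (act k h (fun w => w ^ j)) (fun w => w ^ n) (rot u * γ * (h * rot v * h⁻¹)) *
          ((u : ℂ) ^ p * (starRingEnd ℂ) ((v : ℂ) ^ q)) ∂haarCircle ∂haarCircle‖ ≤
      decayConst k j n * monomialNormSq k n *
        (kappa (starRingEnd ℂ) dd (colBasis h) (mat γ)).re ^ (-(k : ℝ) / 2) := by
  rw [torus_orbital_conj_eq k j n hk h γ p q, norm_mul, norm_mul, kappa_eq_normSq, Complex.ofReal_re]
  have h1 : ‖(if p = ((k + 2 * n : ℕ) : ℤ) then (1 : ℂ) else 0)‖ ≤ 1 := by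
    split_ifs <;> simp
  have h2 : ‖(if (-(k + 2 * j : ℕ) : ℤ) = q then (1 : ℂ) else 0)‖ ≤ 1 := by
    split_ifs <;> simp
  have hc := norm_matrixCoeff_monomial_monomial_le k hk (γ * h) j n
  rw [inv_pow_eq_normSq_rpow (mat_zero_zero_ne_zero (γ * h)) k] at hc
  have hC : 0 ≤ decayConst k j n * monomialNormSq k n *
      Complex.normSq (mat (γ * h) 0 0) ^ (-(k : ℝ) / 2) := le_trans (norm_nonneg _) hc
  calc ‖(if p = ((k + 2 * n : ℕ) : ℤ) then (1 : ℂ) else 0)‖ *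
        ‖(if (-(k + 2 * j : ℕ) : ℤ) = q then (1 : ℂ) else 0)‖ *
        ‖matrixCoeff k (fun w => w ^ j) (fun w => w ^ n) (γ * h)‖
      ≤ 1 * 1 * (decayConst k j n * monomialNormSq k n *
          Complex.normSq (mat (γ * h) 0 0) ^ (-(k : ℝ) / 2)) := by
        gcongr
    _ = decayConst k j n * monomialNormSq k n * Complex.normSq (mat (γ * h) 0 0) ^ (-(k : ℝ) / 2) := by
        ring

end Summit.Ventures.HodgeRepro2.T7SupportBergmanOrbitalDecay
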